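import Mathlib
import Summits.QuantumFields.QCD.Theses.PauliWegnerSea
import Literature.Analysis.TotalPositivity.MultiplyPositiveProofs

/-!
# Stub `stub_gramInequality` of line `crossing-split-integrability` (r5)
(crux `Summit.QuantumFields.QCD.Theses.PauliWegnerSea.PhaseQuenchedFlavourDecay`, item stmt-QuantumFields-9151)

The deterministic GRAM INEQUALITY of the r5 reshape: for a square complex matrix `G` and index maps
`I J : Fin r → Fin n`, the `r × r` minor `det G[I,J]` is dominated by the principal minor, at the rows
`I`, of the Gram matrix `G Gᴴ` of the rows:
`‖det G[I,J]‖² ≤ Re det((G Gᴴ)[I,I])`.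

Proof.  With `A := G[I,·] : Matrix (Fin r) (Fin n) ℂ` one has `(G Gᴴ)[I,I] = A Aᴴ`, and the tree's
Cauchy–Binet formula `Literature.Analysis.TotalPositivity.det_mul_eq_sum_strictMono` gives
`det (A Aᴴ) = Σ_t det A[·,t] · det (A[·,t])ᴴ = Σ_t ‖det A[·,t]‖²`, the sum over strictly increasing
`t : Fin r → Fin n` (`re_det_mul_conjTranspose_eq_sum`).  If `J` is not injective, `det G[I,J] = 0`
(two equal columns); otherwise `J = t₀ ∘ σ` with `t₀ := J ∘ Tuple.sort J` increasing and `σ` a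
permutation, so `‖det G[I,J]‖ = ‖det A[·,t₀]‖` (`Matrix.det_permute'`), one term of the sum.
-/

noncomputable section

namespace Summit.QuantumFields.QCD.Cruxes.PhaseQuenchedFlavourDecay.CrossingSplitIntegrability

open scoped BigOperators
open Matrix Literature.Analysis.TotalPositivity

open scoped Classical in
/-- `Re det (A Aᴴ) = Σ_t ‖det A[·,t]‖²`, the sum over strictly increasing column selections
`t : Fin k → Fin n` (Cauchy–Binet with `B = Aᴴ`, `det Mᴴ = conj (det M)`). -/
theorem re_det_mul_conjTranspose_eq_sum {k n : ℕ} (A : Matrix (Fin k) (Fin n) ℂ) :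
    (A * Aᴴ).det.re =
      ∑ t ∈ (Finset.univ : Finset (Fin k → Fin n)).filter (fun t => StrictMono t),
        ‖(A.submatrix id t).det‖ ^ 2 := by
  rw [det_mul_eq_sum_strictMono, Complex.re_sum]
  refine Finset.sum_congr rfl fun t _ => ?_
  rw [← conjTranspose_submatrix, det_conjTranspose, Complex.star_def, Complex.mul_conj',
    ← Complex.ofReal_pow, Complex.ofReal_re]

/-- An injective column selection `p` is a permutation of a strictly increasing one `t` with the same
`‖det A[·,t]‖` (`t := p ∘ Tuple.sort p`, `Matrix.det_permute'`, `‖sign‖ = 1`). -/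
theorem exists_strictMono_norm_det_submatrix_eq {k n : ℕ} (A : Matrix (Fin k) (Fin n) ℂ)
    {p : Fin k → Fin n} (hp : Function.Injective p) :
    ∃ t : Fin k → Fin n, StrictMono t ∧ ‖(A.submatrix id t).det‖ = ‖(A.submatrix id p).det‖ := by
  refine ⟨p ∘ Tuple.sort p,
    (Tuple.monotone_sort p).strictMono_of_injective (hp.comp (Tuple.sort p).injective), ?_⟩
  have h : A.submatrix id (p ∘ ⇑(Tuple.sort p)) = (A.submatrix id p).submatrix id (Tuple.sort p) :=
    rfl
  rw [h, det_permute', norm_mul]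
  rcases Int.units_eq_one_or (Equiv.Perm.sign (Tuple.sort p)) with hs | hs <;> simp [hs]

/-- Registered stub `stub_gramInequality` (r5) of line `crossing-split-integrability` for crux
stmt-QuantumFields-9151 — the Gram inequality `‖det G[I,J]‖² ≤ Re det((G Gᴴ)[I,I])` for every square
complex matrix `G` and index maps `I J : Fin r → Fin n`. -/
theorem stub_gramInequality :
    ∀ (n r : ℕ) (G : Matrix (Fin n) (Fin n) ℂ) (I J : Fin r → Fin n),
      ‖(Matrix.of fun a b : Fin r => G (I a) (J b)).det‖ ^ 2 ≤
        (Matrix.of fun a b : Fin r => (G * G.conjTranspose) (I a) (I b)).det.re := by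
  intro n r G I J
  have hJ : (Matrix.of fun a b : Fin r => G (I a) (J b)) = (G.submatrix I id).submatrix id J := rfl
  have hG : (Matrix.of fun a b : Fin r => (G * G.conjTranspose) (I a) (I b)) =
      G.submatrix I id * (G.submatrix I id)ᴴ := by
    ext a b
    simp [Matrix.mul_apply]
  rw [hJ, hG, re_det_mul_conjTranspose_eq_sum]
  by_cases hinj : Function.Injective J
  · obtain ⟨t₀, ht₀, heq⟩ := exists_strictMono_norm_det_submatrix_eq (G.submatrix I id) hinj
    rw [← heq]
    exact Finset.single_le_sum (f := fun t => ‖((G.submatrix I id).submatrix id t).det‖ ^ 2)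
      (fun t _ => sq_nonneg _) (Finset.mem_filter.2 ⟨Finset.mem_univ _, ht₀⟩)
  · rw [det_submatrix_eq_zero_of_not_injective _ hinj, norm_zero, zero_pow two_ne_zero]
    exact Finset.sum_nonneg fun t _ => sq_nonneg _

end Summit.QuantumFields.QCD.Cruxes.PhaseQuenchedFlavourDecay.CrossingSplitIntegrability

end
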